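import Literature.MathematicalPhysics.QuantumFieldTheory.Balaban1983to89.B15Ineq184BlockAxial

/-!
# `Balaban1983to89.B15Layer130Lattice` — T. Bałaban, *Large field renormalization. I. The basic step of the 𝐑
# operation*, Commun. Math. Phys. **122** (1989) 175–202 [Balaban1989LargeFieldI] ("[IV]") and *Convergent
# renormalization expansions for lattice gauge theories*, Commun. Math. Phys. **119** (1988) 243–285
# [Balaban1988Convergent] ("[III]"): THE ARGUMENT FIELD `(1/i)log[M˙(U)(M˙(Q^{s*}V))⁻¹]` OF THE STANDARD
# REPRESENTATIONS (1.30), (1.56), (1.90) [IV] and (3.17) [III] — the printed sentence *"equal to 0 on almost the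
# whole cube □^{∼4}, except a boundary layer of the width 2M₁ … On this boundary the field can be bounded by 22d²ε_j,
# by the argument leading to the estimate (1.65) in [14]"* ([IV] p. 183–184) and its three printed twins — PROVED on
# the `ℤ^d` carriers of the tree from the general-background descent of [14] (1.65) with the pull-back tower
# `Q^{s*}_nV` as background (the (3.6) [III] p. 266 version, top discrepancy `2δ_k` from (3.3), is the sibling file
# `B14Ineq37From190`)

statement-level skeleton of published theorems with citation tags; proofs where landed; nothing here is a claim about the Yang–Mills mass gap

PDF held: `paper:balaban1989-cmp122-large-field-i` (journal page = PDF page + 174; pp. 182–184 = PDF pp. 8–10, p. 188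
= PDF p. 14, pp. 197–198 = PDF pp. 23–24) and `paper:balaban1988-cmp119-convergent-renormalization` (journal page = PDF
page + 242; p. 256 = PDF p. 14, pp. 265–268 = PDF pp. 23–26); every quotation below was READ AS AN IMAGE on the x2
renders `run/shared/lean/pub/pub-balaban/b2b-balaban-ref1/pages/1989-cmp122-large-field-I/…-p008,p009,p010,p014,p023,
p024-x2.png` and `…/1988-cmp119-convergent-renormalization/…-p014,p023,p024,p026-x2.png`.  "[14]" = [Balaban1985RegularSpaces]
(1.65) p. 87, "[12]" = [Balaban1985Averaging] (26) p. 22, (8)/(45) pp. 18/24.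

WHAT IS REPRODUCED (mega-formalization `lit-balaban`, HOME `run/shared/lean/pub/lit-balaban/`, Phase-2 proof seat p29,
generation 7, free-target protocol G.5-34(d); SKELETON rows **B15.Eq1.30** (r12; the sentence after (1.30), whose typed
schema is `B15StandardRep.Layer130`/`SmallOffLayer` — the B-size `22d²ε_j` consumed as the hypothesis `hm` of r12's
`B15Ineq131Input.boundH130_of_ineq190`), **B15.Eq1.56** (the sentence after (1.56), `B15StandardRep.Layer156`, B-size
`44d²B₃ε_k` of `B15HDecayLeaves.ineq157_first_of_ineq190`), **B15.Eq1.90** (the B-size `11d²ε_h` of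
`B15HDecayLeaves.boundH190_of_ineq190`) and **B14.Eq3.16–3.19** (r11; p. 268 *"hence the argument of the function
𝐇_{k+1,□′} is bounded by 44d²B₃ε_{k+1}, and has a support in a boundary layer"*, the located input of (3.18)); the
general theorem `norm_argField_le` (top discrepancy `α₁`) also serves (3.6) [III] p. 266 (`α₁ = 2δ_k`, sibling file
`B14Ineq37From190`, row B14.Claim@265); referee ref-5).

THE PRINTED TEXT (verbatim).  [IV] p. 183–184 [PDF 9–10]: *"Let us start with a function (1.3). The cube □ is
contained in Ω_j^{∼4}∖Ω^∼_{j+1}, hence □^{∼4} ⊂ Ω_{j−1}∖Ω_{j+1}. On this domain the configuration U_k^{(n)} satisfies the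
last inequality in (1.24) (with c = 1), and the constraints M^j(U_k^{(n)}) = V_j. The same constraints are satisfied
by U_{j,□} on □^{∼3}. Reasoning as in the part of Sect. 3 [III] between the formulas (3.6), (3.8), we get U_{j,□} =
(exp iξℍ_{j,□}(−(1/i)log[M˙(U_k^{(n)})(M˙(Q_j^{s*}V_j))⁻¹]) U_k^{(n)})^{u⁻¹_{j,□}}. (1.30) The field in the argument of the
function ℍ_{j,□} is equal to 0 on almost the whole cube □^{∼4}, except a boundary layer of the width 2M₁ in the lattice
T_ξ, ξ = L^{−j}. On this boundary the field can be bounded by 22d²ε_j, by the argument leading to the estimate (1.65) in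
[14]."*; (1.24) p. 182, last line: *"|U^{(n)}_{k,Z}(∂p) − 1| < c(1 − β½)ε_j(L^{k−j}η)² for p ∈ Ω_{j−1}∖Ω_{j+1} … where
c = 1 for j < k"*.  [IV] p. 188 [PDF 14]: *"Once more we write the representation U_k^{(n+1)} = (exp iηℍ^{(n+1)}_{k,Z}(
(1/i)log[M˙(U_k^{(n+1)})(M˙(Q_k^{s*}V_k))⁻¹]) U^{(n+1)}_{k,Z})^{(u^{(n+1)}_{k,Z})⁻¹}. (1.56) The field in the argument of the
function ℍ^{(n+1)}_{k,Z} has a support in the boundary layer of the width 2M₁ at the boundary of Z, and is bounded by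
44d²B₃ε_k."*  [IV] p. 198 [PDF 24]: *"U″_{k,Z} = U(𝐁_h(□^{∼4}), [M˙(U″_{k,Z})(M˙(Q_h^{s*}V″))⁻¹]M˙(Q_h^{s*}V″)) = (exp
iL^{k−h}ηℍ_{h,□}((1/i)log[M˙(U″_{k,Z})(M˙(Q_h^{s*}V″))⁻¹]) U_{h,□}(V″))^{u⁻¹_{h,□}}. (1.90) The function ℍ_{h,□} and it[s]
derivatives can be bounded on □^∼ by B₃exp(−δ2LM₂R_h)11d²ε_h"*.  [III] p. 268 [PDF 26]: *"U_{k+1} = U(𝐁_{k+1}(□′^{∼4}), [M˙(U_{k+1})(M˙(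
Q^{s*}_{k+1}V_{k+1}))⁻¹]M˙(Q^{s*}_{k+1}V_{k+1})) = (exp iL⁻¹η𝐇_{k+1,□′}((1/i)log[M˙(U_{k+1})(M˙(Q^{s*}_{k+1}V_{k+1}))⁻¹])
U_{k+1,□′})^{u⁻¹_{k+1,□′}}. (3.17) The field U_{k+1} satisfies the regularity condition |∂U_{k+1} − 1| < 2B₃ε_{k+1}(L⁻¹η)²
on Ω_{k+1}, hence the argument of the function 𝐇_{k+1,□′} is bounded by 44d²B₃ε_{k+1}, and has a support in a boundary
layer of the width 2LM₁ at the boundary of □′^{∼4}."*  The determining set, [III] p. 256 [PDF 14]: *"a sequence of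
maximal domains Ω = Ω₀ ⊃ Ω₁ ⊃ … ⊃ Ω_j such that Ω_n is a union of L^nξM₁-cubes, and dist(Ω_n, Ω^c_{n−1}) ≧ L^nξM₁ …
It is easy to see that dist(Ω_j, Ω^c) ≦ 2M₁, or Ω^{∼−2} ⊂ Ω_j … We denote this determining set by 𝐁_j(Ω)"* and (2.11)
*"M_𝐁(U) = M^j(U) on Γ_j"*.  [14] (1.65) p. 87: *"|(\overline{U′U₀})ʲ − Ū₀ʲ| = |Ũ′ʲ − 1| < 8d²α₀/(1 − L⁻²) + α₁ <
11d²α₀ + α₁"*; [12] (26) p. 22: *"|log X| ≤ … ≤ 2|X − 1|"*.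

THE PROOF (*"the reasoning leading to (1.65)"*, unfolded).  The multi-level average `M˙(U) = M_{𝐁_j(□^{∼4})}(U)` is
`M^{j−n}(U)` on the depth-`n` component of the determining set ((2.11) [III]); the multi-level average of the full
pull-back `Q_j^{s*}V` is the partial pull-back, `M^{j−n}(Q_j^{s*}V) = Q^{s*}_nV`, by the section property
`\overline{Q^{s*}W} = W` of the average (42) of [12] (`B15Ineq184BlockAxial.bavg_pull`).  Hence at depth `n` and a bond
`b` the argument field is `(1/i)log[M^{j−n}(U)(b)((Q^{s*}_nV)(b))⁻¹]`, i.e. on the `ℤ^d` carriers `log[avgIter L U (j − n)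
b · (pullIter L V n b)⁻¹]` (§3–§4 state both orders of the ratio; `(1/i)` and the sign of (1.30) do not change the
norm).  `§1`: `|log[pq⁻¹]| ≤ 2|p − q|` for unit-norm bond variables ([14]: `|p − q| = |pq⁻¹ − 1|`,
`B8Ineq165Descent.norm_sub_eq_norm_pert`; [12] (26), `MatrixLog.norm_mlog_le_two_mul`).  `§2`: the general-background
descent of [14] (`B8Ineq165Descent.descent_bg`, p26) with the background TOWER `Bg n = Q^{s*}_nV`: tower consistency
= the section property, background plaquettes `= 1` on every two-block region (`plaqSmall_pull_pair` — this is why the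
pull-back, which is NOT `α₀η²`-regular at block corners, may serve as the background: *"or rather … the reasoning
leading to that inequality"*), relative axial gauge (1.19) = the plain axial gauge in blocks (1.15) of [14]
(`axialFn_pull_eq_one`), top closeness `α₁` (`= 0` under the constraint `M^j(U) = V`; `= 2δ_k` from (3.3) for (3.6)
[III], sibling file);
with Proposition 2 of [12] at every level (`B8Ineq130.ineq128_global`: `|∂M^{j−n}(U) − 1| < 2α(L^{−n})²·L²…`, here in
the tree's depth bookkeeping) this gives `|M^{j−n}(U)(b) − (Q^{s*}_nV)(b)| ≤ α₁ + 8d²α(L^{−2(n−1)} + … + 1) < α₁ + 11d²α`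
(`norm_avg_sub_pullIter_le`, `norm_avg_sub_pullIter_lt`), hence the field bound `2α₁ + 2·8d²α(…) < 2α₁ + 22d²α`
(`norm_argField_le`).  `§3`: under the top constraint the field VANISHES at the top level (`argField_top_eq_zero` —
*"equal to 0 on almost the whole cube"*; that the lower components of `𝐁_j(□^{∼4})` lie within `2M₁` of `∂□^{∼4}` is
the geometry *"dist(Ω_j, Ω^c) ≦ 2M₁"* of [III] p. 256, row B14.Eq2.13, `B14Eq213MaximalDomains`, not re-proved here)
and is `< 22d²α` below it (`argField_lt`); the printed constants are the instances `α = ε_j` [(1.24), c = 1: `22d²ε_j`,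
`layer130_lt`], `α = 2B₃ε_k` [(1.56): `44d²B₃ε_k`, `layer156_lt`], `α = 2B₃ε_{k+1}` [(3.17): `44d²B₃ε_{k+1}`, `layer317_lt`],
`α = ½ε_h` [(1.90): `11d²ε_h`, `layer190_lt`] — ONE formula `2·11d²·α` reproduces all four printed numbers (and, with
`α₁ = 2δ_k`, the `4δ_k + …` of (3.6) [III], sibling file).  ORBIT VERSIONS (`argField_lt_orbit`, `layer130_lt_orbit`):
the argument field is not
gauge invariant; the block-axial gauge EXISTS for every `G`-valued field (`B8Eq115GaugeFixing.gaugeFix_global`, [14] p.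
78), (1.24) is gauge invariant, and the bounds hold for that representative — [IV] p. 197 *"We take it in the axial
gauge in k-blocks"*; in (1.30) the compensating transformation is absorbed in `u_{j,□}`.

DICTIONARY (as in `B8Ineq130` / `B15Ineq184BlockAxial`, headers there).  Every level is `ℤ^d`, the level below is its
`L`-fold refinement; the TOP lattice of the determining set (`T^{(j)}` for (1.30), `T^{(k)}` for (1.56), the
`L`-lattice `T^{(k+1)}` for (3.17), `T^{(h)}` for (1.90)) carries the top cube `[lo, hi]` (`= (□^{∼4})^{(j)}` or any cube
containing it); depth `n` ↦ the cube `[tlo L lo n, thi L hi n]`; the fine field `U` (`U_k^{(n)}`, `U_k^{(n+1)}`,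
`U_{k+1}`, `U″_{k,Z}`) sits at depth `K` (`= j`, `k`, `k+1`, `k−h`: print's `ξ = L^{−j} = L^{k−j}η`, `η`, `L⁻¹η`,
`L^{k−h}η` measured from the top lattice), `M^{K−n}(U) = avgIter L U (K − n)` ((43) of [12]),
`Q^{s*}_nV = pullIter L V n` ([III] (1.3), `B15Ineq184BlockAxial.pull`); the fine plaquette hypotheses in the GLOBAL
sup form `pdev U < α·L^{−2K}` (`B7Prop2Explicit.pdev`; gauge invariant); "axial gauge in blocks" = (1.15) of [14]
between all consecutive levels on the cubes (`h15`, as in `B8Ineq130.descent`); `(1/i)log` = the series (21) of [12]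
`MatrixLog.mlog` (the `1/i` dropped: same norm).

HONEST SCOPE / DEVIATIONS.  (1) `ℤ^d` carriers and an `AvgClosed` value group `G ≤ U1 𝔸` of a complete normed
`ℂ`-algebra (`U(N)`, `SU(N)`: `B7Prop2Explicit`, `B7Prop2SpecialUnitary`), as in all B7/B8 `ℤ^d` files; fine plaquette
bounds in the global sup form (the abstract `norm_avg_sub_pullIter_le` is local: per-level plaquette hypotheses on the
cubes only).  (2) The constraint *"M^j(U_k^{(n)}) = V_j"* (and `M^k = V_k`, `M^{k+1} = V_{k+1}`, `M^h = V″`) is read as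
the DEFINITION of the top field, `V := avgIter L U K`; nothing of the variational problems `U(𝔹, ·)` (existence,
minimality, (1.18)) or of the `ℍ`-functions is used or asserted — the file bounds the ARGUMENT of `ℍ`, which is what
the quoted sentences assert.  (3) The multi-level average `M˙ = M_𝐁` is taken componentwise at face value ((2.11):
`M^{j−n}` at depth `n`); the identification of the depth-`n` component with a layer at distance `≤ 2M₁` from `∂□^{∼4}`
is the geometry of [III] p. 256 (row B14.Eq2.13) and is not restated; the theorems hold on the WHOLE cube tower, a
superset of the components.  (4) Constants: `22d²α` is `2·11d²α` with [14]'s `11` (the descent gives `2·(32/3)d²α`,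
strict); (1.56)/(1.90): print does not restate the regularity of the fine field next to the sentence — the hypotheses
`2B₃ε_kη²` / `½ε_h(L^{k−h}η)²` are READ OFF the printed constants (`44d²B₃ε_k = 2·11d²·2B₃ε_k`, as printed for the twin
(3.17); `11d²ε_h = 2·11d²·½ε_h`, the scale `½ε_h` of `χ_{h,1/2}` (1.88)) and are labelled so in the docstrings.  (5)
Smallness
("for α₀ small", Prop. 1/2 of [12], Lemma 1 of [14]) explicit: `C₀α ≤ ⅓`, `2α ≤ c₂′`, `α₁ + 11d²α ≤ 1/6`.  Every
declaration is a proved theorem; no `def`, no new `Prop` fact; standard axioms.  Unit `lit-balaban-p29`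
(literature-prover-lit-balaban-p29-g7-0).
-/

noncomputable section

open scoped BigOperators
open NormedSpace Finset

namespace Literature.MathematicalPhysics.QuantumFieldTheory.Balaban1983to89.B15Layer130Lattice

open MatrixLog B7Prop1Explicit B7Prop2Explicit B8Lemma1NonAbelian B8Ineq129 B8Ineq130 B8Ineq165Descent
  B15Ineq184BlockAxial B7AvgGaugeCovariance B8Eq115GaugeFixing

-- `Site` alone would resolve to the torus sites of `Setup.lean`; re-export the `ℤ^d` sites of `B7Prop1Explicit`.
export B7Prop1Explicit (Site)

variable {d : ℕ}

/-! ## §1 The logarithm of a ratio of unit-norm bond variables: `|(1/i)log[p q⁻¹]| ≤ 2|p − q|` -/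

section Log

variable {𝔸 : Type*} [NormedRing 𝔸] [NormOneClass 𝔸] [NormedAlgebra ℂ 𝔸] [CompleteSpace 𝔸]

/-- `‖log(p q⁻¹)‖ ≤ 2‖p − q‖` for a unit-norm `q` and `‖p − q‖ ≤ ½`: the identity `|p − q| = |pq⁻¹ − 1|` of
[14] (1.65) (`B8Ineq165Descent.norm_sub_eq_norm_pert`) and (26) of [12] `|log X| ≤ 2|X − 1|`
(`norm_mlog_le_two_mul`) — the step *"hence it can be bounded by 4δ_k"* of [III] p. 266 (a factor `2` on the bound
`2δ_k` of (3.3)). [cite: Balaban1988Convergent, p.266 (after (3.6)); Balaban1985Averaging, (26) p.22] -/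
theorem norm_mlog_ratio_le {p q : 𝔸ˣ} (hq : q ∈ U1 𝔸) (h : ‖(p : 𝔸) - q‖ ≤ 1 / 2) :
    ‖mlog (((p * q⁻¹ : 𝔸ˣ) : 𝔸))‖ ≤ 2 * ‖(p : 𝔸) - q‖ := by
  rw [norm_sub_eq_norm_pert hq] at h ⊢
  exact norm_mlog_le_two_mul h

/-- The same with the ratio reversed: `‖log(q p⁻¹)‖ ≤ 2‖p − q‖` for a unit-norm `p`.
[cite: Balaban1988Convergent, p.266 (after (3.6)); Balaban1985Averaging, (26) p.22] -/
theorem norm_mlog_ratio_le' {p q : 𝔸ˣ} (hp : p ∈ U1 𝔸) (h : ‖(p : 𝔸) - q‖ ≤ 1 / 2) :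
    ‖mlog (((q * p⁻¹ : 𝔸ˣ) : 𝔸))‖ ≤ 2 * ‖(p : 𝔸) - q‖ := by
  rw [norm_sub_rev] at h ⊢
  exact norm_mlog_ratio_le hp h

omit [NormOneClass 𝔸] [CompleteSpace 𝔸] in
/-- `log(p p⁻¹) = log 1 = 0`: where the two multi-level averages agree the argument field vanishes (*"is equal to 0
on almost the whole cube"*, [IV] p. 183). [cite: Balaban1989LargeFieldI, p.183 (after (1.30))] -/
theorem mlog_ratio_self (p : 𝔸ˣ) : mlog (((p * p⁻¹ : 𝔸ˣ) : 𝔸)) = 0 := by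
  rw [mul_inv_cancel, Units.val_one, mlog_one]

end Log

/-! ## §2 *"the reasoning leading to (1.65) [14]"* with the pull-back tower as background and a top discrepancy -/

section Descent

variable {𝔸 : Type*} [NormedRing 𝔸] [NormOneClass 𝔸] [NormedAlgebra ℂ 𝔸] [CompleteSpace 𝔸]

/-- **The (1.65)-reasoning, abstract local form.**  On the tower of cubes `[tlo n, thi n]` below the top cube
`[lo, hi]` (depth `n`, top depth `0`, fine field at depth `k`): let the averages `avgIter L U j` of the fine field
`U` be unit-norm-valued, let the depth-`n` average have plaquette variables within `a_n` of `1` on its cube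
(`n ≥ 1`), let `U` be in the axial gauge in blocks ((1.15) of [14]) between all consecutive levels on the cubes, and
let the TOP average be within `α₁` of a unit-norm-valued top field `V` on the bonds of `[lo, hi]`.  Then the
general-background descent of [14] (`B8Ineq165Descent.descent_bg`) with the background tower of pull-backs `Q^{s*}_nV`
([III] (1.3); tower consistency = the section property `bavg_pull`, background plaquettes `= 1` on block pairs
`plaqSmall_pull_pair`, relative gauge (1.19) = (1.15) by `axialFn_pull_eq_one`) gives, for every bond
`b = ⟨x, x + e_ν⟩` of the depth-`n` cube: `|avgIter L U (k − n) b − (Q^{s*}_nV)(b)| ≤ α₁ + Σ_{m<n} 4d²L²a_{m+1}`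
(under `a_nL² ≤ 1/(6(d+1))`, `α₁ + Σ_{m<k} 4d²L²a_{m+1} ≤ 1/6`).
[cite: Balaban1989LargeFieldI, p.183 (after (1.30)); Balaban1985RegularSpaces, (1.65) p.87] -/
theorem norm_avg_sub_pullIter_le {L : ℕ} (hL : 1 ≤ L) (hd : 1 ≤ d) (lo hi : Site d)
    (U V : Site d → Fin d → 𝔸ˣ) (k : ℕ) (a : ℕ → ℝ) (α₁ : ℝ)
    (hmem : ∀ j ≤ k, ∀ x μ, avgIter L U j x μ ∈ U1 𝔸) (hV : ∀ x μ, V x μ ∈ U1 𝔸)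
    (hplaq : ∀ n, 1 ≤ n → n ≤ k →
      B8Lemma1NonAbelian.PlaqSmall (avgIter L U (k - n)) (tlo L lo n) (thi L hi n) (a n))
    (h15 : ∀ n, n < k → ∀ z, tlo L lo n ≤ z → z ≤ thi L hi n → ∀ r : Fin d → Fin L,
      axialFn (avgIter L U (k - (n + 1))) ((L : ℤ) • z) ((L : ℤ) • z + boxVec L r) = 1)
    (htop : ∀ x ν, lo ≤ x → x + e ν ≤ hi → ‖((avgIter L U k x ν : 𝔸ˣ) : 𝔸) - V x ν‖ ≤ α₁) (hα₁ : 0 ≤ α₁)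
    (ha : ∀ n, 1 ≤ n → n ≤ k → 0 < a n ∧ a n * (L : ℝ) ^ 2 ≤ 1 / (6 * ((d : ℝ) + 1)))
    (htot : α₁ + ∑ m ∈ Finset.range k, 4 * (d : ℝ) ^ 2 * (L : ℝ) ^ 2 * a (m + 1) ≤ 1 / 6)
    (n : ℕ) (hn : n ≤ k) (x : Site d) (ν : Fin d) (hx : tlo L lo n ≤ x) (hxν : x + e ν ≤ thi L hi n) :
    ‖((avgIter L U (k - n) x ν : 𝔸ˣ) : 𝔸) - pullIter L V n x ν‖ ≤
      α₁ + ∑ m ∈ Finset.range n, 4 * (d : ℝ) ^ 2 * (L : ℝ) ^ 2 * a (m + 1) :=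
  descent_bg hL hd lo hi U (pullIter L V) k a α₁ hmem (fun m _ x μ => pullIter_mem L hV m x μ) hplaq
    (fun m _ z _ _ κ => by
      rw [pullIter_succ]; exact plaqSmall_pull_pair hL _ z κ (ha (m + 1) (by omega) (by omega)).1.le)
    (fun m hmk z hz hz' r => by rw [h15 m hmk z hz hz' r, pullIter_succ, axialFn_pull_eq_one hL hd])
    (fun m _ z κ _ _ => by rw [pullIter_succ, bavg_pull hL])
    (fun x ν hx' hxν' => by simpa using htop x ν hx' hxν') hα₁ ha htot n hn x ν hx hxν

/-- **The (1.65)-reasoning with the printed constants, global `ℤ^d` carrier.**  `U` `G`-valued (`G` closed under the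
average (42) of [12], e.g. `U(N)`), fine plaquettes `|U(∂p) − 1| < αξ²` everywhere (`ξ = L^{−k}` the fine spacing in
units of the top lattice; global sup form), `α` Prop.-1/2-small, the top average within `α₁` of a unit-norm-valued `V`
on `[lo, hi]`, `α₁ + 11d²α ≤ 1/6`, and `U` in the axial gauge in blocks on the cube tower.  Then at every depth
`n ≤ k` and every bond `b` of the depth-`n` cube: `|avgIter L U (k − n) b − (Q^{s*}_nV)(b)| ≤ α₁ + 8d²α(L^{−2(n−1)} + …
+ 1) < α₁ + 11d²α` (Prop. 2 of [12] at every level `B8Ineq130.ineq128_global`, then `norm_avg_sub_pullIter_le`, then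
the geometric series of (1.65)). [cite: Balaban1989LargeFieldI, p.183 (after (1.30)); Balaban1985RegularSpaces, (1.65) p.87] -/
theorem norm_avg_sub_pullIter_lt (L : ℕ) (hL : 2 ≤ L) (hd : 1 ≤ d) {G : Subgroup 𝔸ˣ} (hG : AvgClosed d L G)
    (k : ℕ) (U : Site d → Fin d → 𝔸ˣ) (hU : ∀ x κ, U x κ ∈ G) {α : ℝ} (hα : 0 < α) (hα3 : C0 d * α ≤ 1 / 3)
    (hα2 : 2 * α ≤ c2' d L) (h17 : pdev U < α * (((L : ℝ) ^ k)⁻¹) ^ 2)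
    (V : Site d → Fin d → 𝔸ˣ) (hV : ∀ x μ, V x μ ∈ U1 𝔸) {α₁ : ℝ} (hα₁ : 0 ≤ α₁)
    (hs : α₁ + 11 * (d : ℝ) ^ 2 * α ≤ 1 / 6) (lo hi : Site d)
    (h15 : ∀ n, n < k → ∀ z, tlo L lo n ≤ z → z ≤ thi L hi n → ∀ r : Fin d → Fin L,
      axialFn (avgIter L U (k - (n + 1))) ((L : ℤ) • z) ((L : ℤ) • z + boxVec L r) = 1)
    (htop : ∀ x ν, lo ≤ x → x + e ν ≤ hi → ‖((avgIter L U k x ν : 𝔸ˣ) : 𝔸) - V x ν‖ ≤ α₁)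
    (n : ℕ) (hn : n ≤ k) (x : Site d) (ν : Fin d) (hx : tlo L lo n ≤ x) (hxν : x + e ν ≤ thi L hi n) :
    ‖((avgIter L U (k - n) x ν : 𝔸ˣ) : 𝔸) - pullIter L V n x ν‖ ≤
        α₁ + 8 * (d : ℝ) ^ 2 * α * ∑ m ∈ Finset.range n, (((L : ℝ) ^ m)⁻¹) ^ 2 ∧
      α₁ + 8 * (d : ℝ) ^ 2 * α * ∑ m ∈ Finset.range n, (((L : ℝ) ^ m)⁻¹) ^ 2 < α₁ + 11 * (d : ℝ) ^ 2 * α := by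
  have hL1 : 1 ≤ L := le_trans (by norm_num) hL
  have hL' : (0 : ℝ) < L := by exact_mod_cast lt_of_lt_of_le (by norm_num) hL
  have hdiv : α / (L : ℝ) ^ 2 * (L : ℝ) ^ 2 = α := div_mul_cancel₀ _ (pow_ne_zero 2 hL'.ne')
  have hβ : 0 < α / (L : ℝ) ^ 2 := by positivity
  have hα3' : C0 d * (α / (L : ℝ) ^ 2 * (L : ℝ) ^ 2) ≤ 1 / 3 := by rw [hdiv]; exact hα3
  have hα2' : 2 * (α / (L : ℝ) ^ 2 * (L : ℝ) ^ 2) ≤ c2' d L := by rw [hdiv]; exact hα2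
  have h17' : pdev U < α / (L : ℝ) ^ 2 * (L : ℝ) ^ 2 * (((L : ℝ) ^ k)⁻¹) ^ 2 := by rwa [hdiv]
  have h128 := fun m hm => ineq128_global L hL hG k U hU hβ hα3' hα2' h17' m hm
  have hmemG := (h128 0 (Nat.zero_le k)).2
  have hmem : ∀ j ≤ k, ∀ x μ, avgIter L U j x μ ∈ U1 𝔸 := fun j hj x μ =>
    hG.le_U1 (hmemG j (by simpa using hj) x μ)
  obtain ⟨hk1, hk2⟩ := ineq165_members hL hd hα k
  have htot : α₁ + ∑ m ∈ Finset.range k, 4 * (d : ℝ) ^ 2 * (L : ℝ) ^ 2 * aLev (α / (L : ℝ) ^ 2) L (m + 1) ≤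
      1 / 6 := by
    rw [descent_sum_eq_printed hL1]; linarith
  have ha : ∀ m, 1 ≤ m → m ≤ k → 0 < aLev (α / (L : ℝ) ^ 2) L m ∧
      aLev (α / (L : ℝ) ^ 2) L m * (L : ℝ) ^ 2 ≤ 1 / (6 * ((d : ℝ) + 1)) := fun m hm1 _ =>
    ⟨by unfold aLev; positivity,
      (aLev_mul_sq_le hL1 hβ.le hm1).trans (by rw [hdiv]; exact two_mul_le_of_C0 hα.le hα3)⟩
  have h := norm_avg_sub_pullIter_le hL1 hd lo hi U V k (aLev (α / (L : ℝ) ^ 2) L) α₁ hmem hV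
    (fun m _ hmk => plaqSmall_of_pdev (hmem _ (by omega)) (h128 m hmk).1.le _ _) h15 htop hα₁ ha htot n hn x ν
    hx hxν
  rw [descent_sum_eq_printed hL1] at h
  obtain ⟨hm1, hm2⟩ := ineq165_members hL hd hα n
  exact ⟨h, by linarith⟩

/-- **THE ARGUMENT FIELD of the standard representations (1.30)/(1.34)/(1.56)/(1.90) [IV] and (3.6)/(3.17) [III],
`(1/i)log[M˙(U)(M˙(Q^{s*}V))⁻¹]`, at depth `n` and a bond `b` of the depth-`n` cube = `log[avgIter L U (k − n) b ·
((Q^{s*}_nV)(b))⁻¹]`, is bounded by `2(α₁ + 8d²α(L^{−2(n−1)} + … + 1)) < 2α₁ + 22d²α`** under the hypotheses of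
`norm_avg_sub_pullIter_lt` (the factor `2` is (26) of [12], `|log X| ≤ 2|X − 1|`); both orders of the ratio.
[cite: Balaban1989LargeFieldI, p.183 (after (1.30)); Balaban1988Convergent, p.266 (after (3.6))] -/
theorem norm_argField_le (L : ℕ) (hL : 2 ≤ L) (hd : 1 ≤ d) {G : Subgroup 𝔸ˣ} (hG : AvgClosed d L G)
    (k : ℕ) (U : Site d → Fin d → 𝔸ˣ) (hU : ∀ x κ, U x κ ∈ G) {α : ℝ} (hα : 0 < α) (hα3 : C0 d * α ≤ 1 / 3)
    (hα2 : 2 * α ≤ c2' d L) (h17 : pdev U < α * (((L : ℝ) ^ k)⁻¹) ^ 2)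
    (V : Site d → Fin d → 𝔸ˣ) (hV : ∀ x μ, V x μ ∈ U1 𝔸) {α₁ : ℝ} (hα₁ : 0 ≤ α₁)
    (hs : α₁ + 11 * (d : ℝ) ^ 2 * α ≤ 1 / 6) (lo hi : Site d)
    (h15 : ∀ n, n < k → ∀ z, tlo L lo n ≤ z → z ≤ thi L hi n → ∀ r : Fin d → Fin L,
      axialFn (avgIter L U (k - (n + 1))) ((L : ℤ) • z) ((L : ℤ) • z + boxVec L r) = 1)
    (htop : ∀ x ν, lo ≤ x → x + e ν ≤ hi → ‖((avgIter L U k x ν : 𝔸ˣ) : 𝔸) - V x ν‖ ≤ α₁)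
    (n : ℕ) (hn : n ≤ k) (x : Site d) (ν : Fin d) (hx : tlo L lo n ≤ x) (hxν : x + e ν ≤ thi L hi n) :
    ‖mlog (((avgIter L U (k - n) x ν * (pullIter L V n x ν)⁻¹ : 𝔸ˣ) : 𝔸))‖ ≤
        2 * (α₁ + 8 * (d : ℝ) ^ 2 * α * ∑ m ∈ Finset.range n, (((L : ℝ) ^ m)⁻¹) ^ 2) ∧
      ‖mlog (((pullIter L V n x ν * (avgIter L U (k - n) x ν)⁻¹ : 𝔸ˣ) : 𝔸))‖ ≤
        2 * (α₁ + 8 * (d : ℝ) ^ 2 * α * ∑ m ∈ Finset.range n, (((L : ℝ) ^ m)⁻¹) ^ 2) ∧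
      2 * (α₁ + 8 * (d : ℝ) ^ 2 * α * ∑ m ∈ Finset.range n, (((L : ℝ) ^ m)⁻¹) ^ 2) <
        2 * α₁ + 22 * (d : ℝ) ^ 2 * α := by
  obtain ⟨h1, h2⟩ := norm_avg_sub_pullIter_lt L hL hd hG k U hU hα hα3 hα2 h17 V hV hα₁ hs lo hi h15 htop n hn
    x ν hx hxν
  have hhalf : ‖((avgIter L U (k - n) x ν : 𝔸ˣ) : 𝔸) - pullIter L V n x ν‖ ≤ 1 / 2 := by linarith
  have hq : pullIter L V n x ν ∈ U1 𝔸 := pullIter_mem L hV n x ν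
  have hL' : (0 : ℝ) < L := by exact_mod_cast lt_of_lt_of_le (by norm_num) hL
  have hdiv : α / (L : ℝ) ^ 2 * (L : ℝ) ^ 2 = α := div_mul_cancel₀ _ (pow_ne_zero 2 hL'.ne')
  have hβ : 0 < α / (L : ℝ) ^ 2 := by positivity
  have hα3' : C0 d * (α / (L : ℝ) ^ 2 * (L : ℝ) ^ 2) ≤ 1 / 3 := by rw [hdiv]; exact hα3
  have hα2' : 2 * (α / (L : ℝ) ^ 2 * (L : ℝ) ^ 2) ≤ c2' d L := by rw [hdiv]; exact hα2
  have h17' : pdev U < α / (L : ℝ) ^ 2 * (L : ℝ) ^ 2 * (((L : ℝ) ^ k)⁻¹) ^ 2 := by rwa [hdiv]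
  have hmemG := (ineq128_global L hL hG k U hU hβ hα3' hα2' h17' 0 (Nat.zero_le k)).2
  have hp : avgIter L U (k - n) x ν ∈ U1 𝔸 := hG.le_U1 (hmemG (k - n) (by simp) x ν)
  exact ⟨(norm_mlog_ratio_le hq hhalf).trans (by linarith), (norm_mlog_ratio_le' hp hhalf).trans (by linarith),
    by linarith⟩

end Descent

/-! ## §3 The case `M^k(U) = V` (top constraint, `α₁ = 0`): *"equal to 0 … except a boundary layer … On this
boundary the field can be bounded by 22d²ε_j"* — [IV] (1.30), (1.56), (1.90), [III] (3.17) -/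

section TopConstraint

variable {𝔸 : Type*} [NormedRing 𝔸] [NormOneClass 𝔸] [NormedAlgebra ℂ 𝔸] [CompleteSpace 𝔸]

omit [NormOneClass 𝔸] in
/-- **[IV] p. 183, "The field in the argument of the function ℍ_{j,□} is equal to 0 on almost the whole cube □^{∼4},
except a boundary layer of the width 2M₁"**: at the TOP level of the determining set `𝐁_j(□^{∼4})` (its component
`Ω_j ⊃ (□^{∼4})^{∼−2}`, [III] p. 256) both multi-level averages are the constraint field, `M^j(U_k^{(n)}) = V_j =
\overline{Q_j^{s*}V_j}^{\,j}`, so the argument `−(1/i)log[M^j(U)(Q^{s*}_0V_j)⁻¹] = −(1/i)log[V_j V_j⁻¹] = 0` — on the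
`ℤ^d` carriers with `V_j := avgIter L U j` (the constraint *"M^j(U_k^{(n)}) = V_j"* read as the definition of the top
field) and `Q^{s*}_0 = id`. [cite: Balaban1989LargeFieldI, p.183 (after (1.30))] -/
theorem argField_top_eq_zero (L : ℕ) (U : Site d → Fin d → 𝔸ˣ) (k : ℕ) (x : Site d) (ν : Fin d) :
    mlog (((avgIter L U k x ν * (pullIter L (avgIter L U k) 0 x ν)⁻¹ : 𝔸ˣ) : 𝔸)) = 0 ∧
      mlog (((pullIter L (avgIter L U k) 0 x ν * (avgIter L U k x ν)⁻¹ : 𝔸ˣ) : 𝔸)) = 0 := by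
  rw [pullIter_zero]; exact ⟨mlog_ratio_self _, mlog_ratio_self _⟩

/-- **[IV] p. 183–184, "On this boundary the field can be bounded by 22d²ε_j, by the argument leading to the estimate
(1.65) in [14]" — GENERIC CONSTANT**: for a `G`-valued fine field `U` with `|U(∂p) − 1| < αξ²` everywhere
(`ξ = L^{−k}`), `α` Prop.-1/2-small with `11d²α ≤ 1/6`, in the axial gauge in blocks on the cube tower, and the top
field `V := M^k(U)` (the constraint), the argument field at every depth `n ≤ k` and every bond `b` of the depth-`n`
cube satisfies `|(1/i)log[avgIter L U (k − n) b · ((Q^{s*}_nV)(b))⁻¹]| < 22d²α = 2·11d²α` (both orders of the ratio).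
[cite: Balaban1989LargeFieldI, p.184 l.1 ((1.65) in [14])] -/
theorem argField_lt (L : ℕ) (hL : 2 ≤ L) (hd : 1 ≤ d) {G : Subgroup 𝔸ˣ} (hG : AvgClosed d L G)
    (k : ℕ) (U : Site d → Fin d → 𝔸ˣ) (hU : ∀ x κ, U x κ ∈ G) {α : ℝ} (hα : 0 < α) (hα3 : C0 d * α ≤ 1 / 3)
    (hα2 : 2 * α ≤ c2' d L) (hαs : 11 * (d : ℝ) ^ 2 * α ≤ 1 / 6) (h17 : pdev U < α * (((L : ℝ) ^ k)⁻¹) ^ 2)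
    (lo hi : Site d)
    (h15 : ∀ n, n < k → ∀ z, tlo L lo n ≤ z → z ≤ thi L hi n → ∀ r : Fin d → Fin L,
      axialFn (avgIter L U (k - (n + 1))) ((L : ℤ) • z) ((L : ℤ) • z + boxVec L r) = 1)
    (n : ℕ) (hn : n ≤ k) (x : Site d) (ν : Fin d) (hx : tlo L lo n ≤ x) (hxν : x + e ν ≤ thi L hi n) :
    ‖mlog (((avgIter L U (k - n) x ν * (pullIter L (avgIter L U k) n x ν)⁻¹ : 𝔸ˣ) : 𝔸))‖ <
        22 * (d : ℝ) ^ 2 * α ∧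
      ‖mlog (((pullIter L (avgIter L U k) n x ν * (avgIter L U (k - n) x ν)⁻¹ : 𝔸ˣ) : 𝔸))‖ <
        22 * (d : ℝ) ^ 2 * α := by
  have hL' : (0 : ℝ) < L := by exact_mod_cast lt_of_lt_of_le (by norm_num) hL
  have hdiv : α / (L : ℝ) ^ 2 * (L : ℝ) ^ 2 = α := div_mul_cancel₀ _ (pow_ne_zero 2 hL'.ne')
  have hβ : 0 < α / (L : ℝ) ^ 2 := by positivity
  have hα3' : C0 d * (α / (L : ℝ) ^ 2 * (L : ℝ) ^ 2) ≤ 1 / 3 := by rw [hdiv]; exact hα3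
  have hα2' : 2 * (α / (L : ℝ) ^ 2 * (L : ℝ) ^ 2) ≤ c2' d L := by rw [hdiv]; exact hα2
  have h17' : pdev U < α / (L : ℝ) ^ 2 * (L : ℝ) ^ 2 * (((L : ℝ) ^ k)⁻¹) ^ 2 := by rwa [hdiv]
  have hmemG := (ineq128_global L hL hG k U hU hβ hα3' hα2' h17' 0 (Nat.zero_le k)).2
  have hV : ∀ x μ, avgIter L U k x μ ∈ U1 𝔸 := fun x μ => hG.le_U1 (hmemG k (by simp) x μ)
  obtain ⟨h1, h2, h3⟩ := norm_argField_le L hL hd hG k U hU hα hα3 hα2 h17 (avgIter L U k) hV le_rfl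
    (by linarith) lo hi h15 (fun x ν _ _ => by rw [sub_self, norm_zero]) n hn x ν hx hxν
  exact ⟨by linarith, by linarith⟩

/-- **THE SAME FOR EVERY ORBIT** (*"We take it in the axial gauge in k-blocks"*, [IV] p. 197; [14] p. 78 "these
equations … determine uniquely an element in each orbit"): for EVERY `G`-valued `U` with `|U(∂p) − 1| < αξ²` (gauge
invariant) the block-axial representative `U′ = U^{u}`, `u = B8Eq115GaugeFixing.towerGauge L U k lo` (which EXISTS,
`B8Eq115GaugeFixing.gaugeFix_global`), satisfies the bound `< 22d²α` of `argField_lt` at every depth and bond of the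
cube tower — the argument field is a statement about this representative (it is not gauge invariant), as (1.30) is.
[cite: Balaban1989LargeFieldI, p.184 l.1 ((1.65) in [14])] -/
theorem argField_lt_orbit (L : ℕ) (hL : 2 ≤ L) (hd : 1 ≤ d) {G : Subgroup 𝔸ˣ} (hG : AvgClosed d L G)
    (k : ℕ) (U : Site d → Fin d → 𝔸ˣ) (hU : ∀ x κ, U x κ ∈ G) {α : ℝ} (hα : 0 < α) (hα3 : C0 d * α ≤ 1 / 3)
    (hα2 : 2 * α ≤ c2' d L) (hαs : 11 * (d : ℝ) ^ 2 * α ≤ 1 / 6) (h17 : pdev U < α * (((L : ℝ) ^ k)⁻¹) ^ 2)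
    (lo hi : Site d) (n : ℕ) (hn : n ≤ k) (x : Site d) (ν : Fin d) (hx : tlo L lo n ≤ x)
    (hxν : x + e ν ≤ thi L hi n) :
    ‖mlog (((avgIter L (gaugeAct (towerGauge L U k lo) U) (k - n) x ν *
        (pullIter L (avgIter L (gaugeAct (towerGauge L U k lo) U) k) n x ν)⁻¹ : 𝔸ˣ) : 𝔸))‖ <
        22 * (d : ℝ) ^ 2 * α ∧
      ‖mlog (((pullIter L (avgIter L (gaugeAct (towerGauge L U k lo) U) k) n x ν *
        (avgIter L (gaugeAct (towerGauge L U k lo) U) (k - n) x ν)⁻¹ : 𝔸ˣ) : 𝔸))‖ <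
        22 * (d : ℝ) ^ 2 * α := by
  have hL' : (0 : ℝ) < L := by exact_mod_cast lt_of_lt_of_le (by norm_num) hL
  have hdiv : α / (L : ℝ) ^ 2 * (L : ℝ) ^ 2 = α := div_mul_cancel₀ _ (pow_ne_zero 2 hL'.ne')
  have hβ : 0 < α / (L : ℝ) ^ 2 := by positivity
  have hα3' : C0 d * (α / (L : ℝ) ^ 2 * (L : ℝ) ^ 2) ≤ 1 / 3 := by rw [hdiv]; exact hα3
  have hα2' : 2 * (α / (L : ℝ) ^ 2 * (L : ℝ) ^ 2) ≤ c2' d L := by rw [hdiv]; exact hα2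
  have h17' : pdev U < α / (L : ℝ) ^ 2 * (L : ℝ) ^ 2 * (((L : ℝ) ^ k)⁻¹) ^ 2 := by rwa [hdiv]
  obtain ⟨_, hU'G, hpdev, _, h15, _⟩ := gaugeFix_global L hL hG k U hU hβ hα3' hα2' h17' lo
  have h180' : pdev (gaugeAct (towerGauge L U k lo) U) < α * (((L : ℝ) ^ k)⁻¹) ^ 2 := by rw [hpdev]; exact h17
  exact argField_lt L hL hd hG k _ hU'G hα hα3 hα2 hαs h180' lo hi (fun n hn z _ _ r => h15 n hn z r) n hn x ν hx hxν

/-- **[IV] (1.30) p. 183–184 WITH THE PRINTED CONSTANT** — *"On this domain the configuration U_k^{(n)} satisfies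
the last inequality in (1.24) (with c = 1) [|U_k^{(n)}(∂p) − 1| < (1 − β½)ε_j(L^{k−j}η)²], and the constraints
M^j(U_k^{(n)}) = V_j. … The field in the argument of the function ℍ_{j,□} is equal to 0 on almost the whole cube
□^{∼4}, except a boundary layer of the width 2M₁ in the lattice T_ξ, ξ = L^{−j}. On this boundary the field can be
bounded by 22d²ε_j, by the argument leading to the estimate (1.65) in [14]."*  On the `ℤ^d` carriers (DICTIONARY in
the module docstring): `U` `G`-valued in the axial gauge in blocks on the cube tower below `□^{(j)} = [lo, hi]`,
(1.24) in the global sup form with `0 ≤ β`, `ε_j` Prop.-1/2-small with `11d²ε_j ≤ 1/6`; then at depth `n ≤ j` and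
every bond `b` of the depth-`n` cube: `|(1/i)log[M^{j−n}(U)(b)((Q^{s*}_nV_j)(b))⁻¹]| < 22d²ε_j`, `V_j = M^j(U)` (and
`= 0` at the top, `argField_top_eq_zero`). [cite: Balaban1989LargeFieldI, p.183–184 (after (1.30))] -/
theorem layer130_lt (L : ℕ) (hL : 2 ≤ L) (hd : 1 ≤ d) {G : Subgroup 𝔸ˣ} (hG : AvgClosed d L G)
    (j : ℕ) (U : Site d → Fin d → 𝔸ˣ) (hU : ∀ x κ, U x κ ∈ G) {β εj : ℝ} (hβ : 0 ≤ β) (hε : 0 < εj)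
    (hε3 : C0 d * εj ≤ 1 / 3) (hε2 : 2 * εj ≤ c2' d L) (hεs : 11 * (d : ℝ) ^ 2 * εj ≤ 1 / 6)
    (h124 : pdev U < (1 - β * (1 / 2)) * εj * (((L : ℝ) ^ j)⁻¹) ^ 2) (lo hi : Site d)
    (h15 : ∀ n, n < j → ∀ z, tlo L lo n ≤ z → z ≤ thi L hi n → ∀ r : Fin d → Fin L,
      axialFn (avgIter L U (j - (n + 1))) ((L : ℤ) • z) ((L : ℤ) • z + boxVec L r) = 1)
    (n : ℕ) (hn : n ≤ j) (x : Site d) (ν : Fin d) (hx : tlo L lo n ≤ x) (hxν : x + e ν ≤ thi L hi n) :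
    ‖mlog (((avgIter L U (j - n) x ν * (pullIter L (avgIter L U j) n x ν)⁻¹ : 𝔸ˣ) : 𝔸))‖ <
      22 * (d : ℝ) ^ 2 * εj := by
  have hq : 0 ≤ (((L : ℝ) ^ j)⁻¹) ^ 2 := by positivity
  have h17 : pdev U < εj * (((L : ℝ) ^ j)⁻¹) ^ 2 := by
    refine h124.trans_le ?_
    have : (1 - β * (1 / 2)) * εj ≤ εj := by nlinarith
    exact mul_le_mul_of_nonneg_right this hq
  exact (argField_lt L hL hd hG j U hU hε hε3 hε2 hεs h17 lo hi h15 n hn x ν hx hxν).1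

/-- **[IV] (1.30) FOR EVERY ORBIT**: the same bound for the block-axial representative `U^{u}`, `u = towerGauge L U j
lo`, of ANY `G`-valued `U` satisfying (1.24) (c = 1) — no gauge hypothesis. [cite: Balaban1989LargeFieldI, p.183–184 (after (1.30))] -/
theorem layer130_lt_orbit (L : ℕ) (hL : 2 ≤ L) (hd : 1 ≤ d) {G : Subgroup 𝔸ˣ} (hG : AvgClosed d L G)
    (j : ℕ) (U : Site d → Fin d → 𝔸ˣ) (hU : ∀ x κ, U x κ ∈ G) {β εj : ℝ} (hβ : 0 ≤ β) (hε : 0 < εj)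
    (hε3 : C0 d * εj ≤ 1 / 3) (hε2 : 2 * εj ≤ c2' d L) (hεs : 11 * (d : ℝ) ^ 2 * εj ≤ 1 / 6)
    (h124 : pdev U < (1 - β * (1 / 2)) * εj * (((L : ℝ) ^ j)⁻¹) ^ 2) (lo hi : Site d)
    (n : ℕ) (hn : n ≤ j) (x : Site d) (ν : Fin d) (hx : tlo L lo n ≤ x) (hxν : x + e ν ≤ thi L hi n) :
    ‖mlog (((avgIter L (gaugeAct (towerGauge L U j lo) U) (j - n) x ν *
        (pullIter L (avgIter L (gaugeAct (towerGauge L U j lo) U) j) n x ν)⁻¹ : 𝔸ˣ) : 𝔸))‖ <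
      22 * (d : ℝ) ^ 2 * εj := by
  have hq : 0 ≤ (((L : ℝ) ^ j)⁻¹) ^ 2 := by positivity
  have h17 : pdev U < εj * (((L : ℝ) ^ j)⁻¹) ^ 2 := by
    refine h124.trans_le ?_
    have : (1 - β * (1 / 2)) * εj ≤ εj := by nlinarith
    exact mul_le_mul_of_nonneg_right this hq
  exact (argField_lt_orbit L hL hd hG j U hU hε hε3 hε2 hεs h17 lo hi n hn x ν hx hxν).1

/-- **[IV] (1.56) p. 188 WITH THE PRINTED CONSTANT** — *"Once more we write the representation U_k^{(n+1)} =
(exp iηℍ^{(n+1)}_{k,Z}((1/i)log[M˙(U_k^{(n+1)})(M˙(Q_k^{s*}V_k))⁻¹]) U^{(n+1)}_{k,Z})^{(u^{(n+1)}_{k,Z})⁻¹}. (1.56) The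
field in the argument of the function ℍ^{(n+1)}_{k,Z} has a support in the boundary layer of the width 2M₁ at the
boundary of Z, and is bounded by 44d²B₃ε_k."*  READING (located): the printed constant is `2·11d²·(2B₃ε_k)`, i.e.
the fine field enters through a plaquette bound `|U_k^{(n+1)}(∂p) − 1| < 2B₃ε_kη²` (the regularity restated in print
for the twin sentence of [III] p. 268, *"|∂U_{k+1} − 1| < 2B₃ε_{k+1}(L⁻¹η)²"*), which is the hypothesis `h` here; top
constraint `M^k = V_k`, hence support in the layer (`argField_top_eq_zero`) and `< 44d²B₃ε_k` on it.
[cite: Balaban1989LargeFieldI, p.188 (after (1.56))] -/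
theorem layer156_lt (L : ℕ) (hL : 2 ≤ L) (hd : 1 ≤ d) {G : Subgroup 𝔸ˣ} (hG : AvgClosed d L G)
    (k : ℕ) (U : Site d → Fin d → 𝔸ˣ) (hU : ∀ x κ, U x κ ∈ G) {B₃ εk : ℝ} (hB₃ : 0 < B₃) (hε : 0 < εk)
    (hs3 : C0 d * (2 * B₃ * εk) ≤ 1 / 3) (hs2 : 2 * (2 * B₃ * εk) ≤ c2' d L)
    (hs : 11 * (d : ℝ) ^ 2 * (2 * B₃ * εk) ≤ 1 / 6) (h : pdev U < 2 * B₃ * εk * (((L : ℝ) ^ k)⁻¹) ^ 2)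
    (lo hi : Site d)
    (h15 : ∀ n, n < k → ∀ z, tlo L lo n ≤ z → z ≤ thi L hi n → ∀ r : Fin d → Fin L,
      axialFn (avgIter L U (k - (n + 1))) ((L : ℤ) • z) ((L : ℤ) • z + boxVec L r) = 1)
    (n : ℕ) (hn : n ≤ k) (x : Site d) (ν : Fin d) (hx : tlo L lo n ≤ x) (hxν : x + e ν ≤ thi L hi n) :
    ‖mlog (((avgIter L U (k - n) x ν * (pullIter L (avgIter L U k) n x ν)⁻¹ : 𝔸ˣ) : 𝔸))‖ <
      44 * (d : ℝ) ^ 2 * B₃ * εk := by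
  have h1 := (argField_lt L hL hd hG k U hU (by positivity) hs3 hs2 hs h lo hi h15 n hn x ν hx hxν).1
  linarith

/-- **[III] (3.17) p. 268 WITH THE PRINTED CONSTANT** — *"U_{k+1} = U(𝐁_{k+1}(□′^{∼4}), [M˙(U_{k+1})(M˙(Q^{s*}_{k+1}
V_{k+1}))⁻¹]M˙(Q^{s*}_{k+1}V_{k+1})) = (exp iL⁻¹η𝐇_{k+1,□′}((1/i)log[M˙(U_{k+1})(M˙(Q^{s*}_{k+1}V_{k+1}))⁻¹]) U_{k+1,□′})^{
u⁻¹_{k+1,□′}}. (3.17) The field U_{k+1} satisfies the regularity condition |∂U_{k+1} − 1| < 2B₃ε_{k+1}(L⁻¹η)² on Ω_{k+1},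
hence the argument of the function 𝐇_{k+1,□′} is bounded by 44d²B₃ε_{k+1}, and has a support in a boundary layer of
the width 2LM₁ at the boundary of □′^{∼4}."*  On the `ℤ^d` carriers: the top lattice is the `L`-lattice `T^{(k+1)}`
carrying `V_{k+1} = M^{k+1}(U_{k+1})`, the fine field is `K = k + 1` levels below it (`L⁻¹η = L^{−(k+1)}` in its
units), the regularity is the global sup form `pdev U < 2B₃ε_{k+1}L^{−2K}`; support = `argField_top_eq_zero`, the
bound `2·11d²·2B₃ε_{k+1} = 44d²B₃ε_{k+1}` EXACTLY. [cite: Balaban1988Convergent, p.268 (after (3.17))] -/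
theorem layer317_lt (L : ℕ) (hL : 2 ≤ L) (hd : 1 ≤ d) {G : Subgroup 𝔸ˣ} (hG : AvgClosed d L G)
    (K : ℕ) (U : Site d → Fin d → 𝔸ˣ) (hU : ∀ x κ, U x κ ∈ G) {B₃ εk1 : ℝ} (hB₃ : 0 < B₃) (hε : 0 < εk1)
    (hs3 : C0 d * (2 * B₃ * εk1) ≤ 1 / 3) (hs2 : 2 * (2 * B₃ * εk1) ≤ c2' d L)
    (hs : 11 * (d : ℝ) ^ 2 * (2 * B₃ * εk1) ≤ 1 / 6) (h : pdev U < 2 * B₃ * εk1 * (((L : ℝ) ^ K)⁻¹) ^ 2)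
    (lo hi : Site d)
    (h15 : ∀ n, n < K → ∀ z, tlo L lo n ≤ z → z ≤ thi L hi n → ∀ r : Fin d → Fin L,
      axialFn (avgIter L U (K - (n + 1))) ((L : ℤ) • z) ((L : ℤ) • z + boxVec L r) = 1)
    (n : ℕ) (hn : n ≤ K) (x : Site d) (ν : Fin d) (hx : tlo L lo n ≤ x) (hxν : x + e ν ≤ thi L hi n) :
    ‖mlog (((avgIter L U (K - n) x ν * (pullIter L (avgIter L U K) n x ν)⁻¹ : 𝔸ˣ) : 𝔸))‖ <
      44 * (d : ℝ) ^ 2 * B₃ * εk1 := by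
  have h1 := (argField_lt L hL hd hG K U hU (by positivity) hs3 hs2 hs h lo hi h15 n hn x ν hx hxν).1
  linarith

/-- **[IV] (1.90) p. 198 WITH THE PRINTED CONSTANT** — *"represent the functions U″_{k,Z} on □^∼ in the usual way:
U″_{k,Z} = U(𝐁_h(□^{∼4}), [M˙(U″_{k,Z})(M˙(Q_h^{s*}V″))⁻¹]M˙(Q_h^{s*}V″)) = (exp iL^{k−h}ηℍ_{h,□}((1/i)log[M˙(U″_{k,Z})(
M˙(Q_h^{s*}V″))⁻¹]) U_{h,□}(V″))^{u⁻¹_{h,□}}. (1.90) The function ℍ_{h,□} and it[s] derivatives can be bounded on □^∼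
by B₃exp(−δ2LM₂R_h)11d²ε_h"* — the B-size `11d²ε_h` of the argument field consumed by r12's
`B15HDecayLeaves.boundH190_of_ineq190`.  READING (located): `11d²ε_h = 2·11d²·(½ε_h)`, i.e. the fine field `U″_{k,Z}`
enters through a plaquette bound `|U″_{k,Z}(∂p) − 1| < ½ε_h(L^{k−h}η)²`, the scale of the restrictions
`χ_{h,1/2}` of (1.88) p. 197 — the hypothesis `h` (a tower of `K = h` levels below `T^{(h)}`: `L^{k−h}η = L^{−h}` for
`η = L^{−k}`, cf. `B15Ineq191Lattice.xi_eq_inv_pow`; v1.1 corrects the v1 slip "`K = k − h`" of this parenthesis — the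
theorem is parametric in `K`); top constraint `M^h(U″) = V″`.
[cite: Balaban1989LargeFieldI, p.198 (after (1.90))] -/
theorem layer190_lt (L : ℕ) (hL : 2 ≤ L) (hd : 1 ≤ d) {G : Subgroup 𝔸ˣ} (hG : AvgClosed d L G)
    (K : ℕ) (U : Site d → Fin d → 𝔸ˣ) (hU : ∀ x κ, U x κ ∈ G) {εh : ℝ} (hε : 0 < εh)
    (hs3 : C0 d * (εh * (1 / 2)) ≤ 1 / 3) (hs2 : 2 * (εh * (1 / 2)) ≤ c2' d L)
    (hs : 11 * (d : ℝ) ^ 2 * (εh * (1 / 2)) ≤ 1 / 6) (h : pdev U < εh * (1 / 2) * (((L : ℝ) ^ K)⁻¹) ^ 2)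
    (lo hi : Site d)
    (h15 : ∀ n, n < K → ∀ z, tlo L lo n ≤ z → z ≤ thi L hi n → ∀ r : Fin d → Fin L,
      axialFn (avgIter L U (K - (n + 1))) ((L : ℤ) • z) ((L : ℤ) • z + boxVec L r) = 1)
    (n : ℕ) (hn : n ≤ K) (x : Site d) (ν : Fin d) (hx : tlo L lo n ≤ x) (hxν : x + e ν ≤ thi L hi n) :
    ‖mlog (((avgIter L U (K - n) x ν * (pullIter L (avgIter L U K) n x ν)⁻¹ : 𝔸ˣ) : 𝔸))‖ <
      11 * (d : ℝ) ^ 2 * εh := by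
  have h1 := (argField_lt L hL hd hG K U hU (by positivity) hs3 hs2 hs h lo hi h15 n hn x ν hx hxν).1
  linarith

end TopConstraint

end Literature.MathematicalPhysics.QuantumFieldTheory.Balaban1983to89.B15Layer130Lattice

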